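/-
Origin: expansion seat `planner-pub-hodgecm-pv08-g4-0`, handover #2 2026-08-18T06:26:22Z (`HOME/pub-hodgecm-pv08-g4/lean/Pv08g4/S5QautFockConservative.lean`, md5 f04fd61e, 364 lines);
landed by the gen-7 packager in gate run 25 as `HodgeCM/PerL34/S5QautFockConservative.lean` (import ^import Pv[0-9]+g[0-9]+\.→import HodgeCM.PerL34. ×1).
-/
/-
Origin: HOME/pub-hodgecm-pv08-g4/lean/Pv08g4/S5QautFockConservative.lean — session planner-pub-hodgecm-pv08-g4-0 (unit
pub-hodgecm-pv08-g4, DAG-NODE PROVER #08 gen 4).  LEMMAS.md v10 §9 seam S5, `N19g`/(34) half; referee A r15/r16 P1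
(STRENGTH of every bridge record).  Intended final place: `HodgeCM/PerL34/S5QautFockConservative.lean`, after this seat's
`HodgeCM/PerL34/S5QautFock.lean` (HANDOVER #1, 2026-08-18T06:19:52Z); the import `Pv08g4.S5QautFock` below is to be
REWRITTEN to `HodgeCM.PerL34.S5QautFock` on landing (the only non-`HodgeCM` import).  New namespace
`HodgeCM.PerL34.QautFock` (continued) / `HodgeCM.PerL34.QautFock.Conservative`.  KERNEL, nothing cited, nothing asserted:
the CONSERVATIVITY WITNESS for the sharpened record, plus the general `K`-equivariance of the lowest-`K`-type projection.
-/
import Summits.HodgeConjecture.HodgeCM.PerL34.S5QautFock_2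

/-!
# Seam S5, `N19g` half: the sharpened record `QautFockBridge` is CONSERVATIVE over the leaf `N19g_core`

`S5QautFock` (this seat, F1) replaced the composite PRINT field `decomp` of pv02-g2's `QautBridge` by theta maps out of the
explicit Fock `J⁺`-piece and derived the `K`-type bookkeeping of PerL v5 Lemma 3.5 (ll. 362–372) in the kernel, proving
`Nonempty (QautFockBridge T V c D k l) → N19g_core T V c D k l` (and `→ Nonempty (QautBridge …)`).

This file proves the CONVERSE, so that — exactly as pv08-g2's `S5ConservativeQaut.nonempty_qautBridge_iff` did for the
landed record — the sharper record is, in logical strength, EXACTLY the leaf: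

* §1 (general, KERNEL over pv12/pv14's model) **the lowest-`K`-type projection is `K`-equivariant**:
  `cv : ℂ[z₁,z₂,w] →ₗ (Fin 2 → ℂ)`, `p ↦ (coeff_{z₁} p, coeff_{z₂} p)` satisfies
  `cv_fockRep : p ∈ J⁺ → cv (fockRep k p) = pPlus k (cv p)` for EVERY `k ∈ U(2) × U(1)` (the substitution `substHom k`
  preserves `z`-degree — `isWeightedHomogeneous_substHom_z`, the `zWt`-twin of pv14-g3's `isWeightedHomogeneous_substHom` —
  so only the `z`-degree-`1` part `zPart 1 p = zLin (cv p)` (F1 `zPart_one_eq_zLin`) contributes, and on the harmonic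
  plane `fockRep` is `pPlus` by pv14-g3's `zLin_equivariant`); hence for every FORM `u` of a shell (`IsForm ρ σ u` with
  `ρ = pPlusMat ∘ κ`) the map `ψOf u := u ∘ cv : J⁺ → C` is a `K`-EQUIVARIANT theta map with `formOf (ψOf u) = u`
  (`ψOf_equivariant`, `formOf_ψOf`).  [This is the kernel form of "`f ↦` the components of the holomorphic one-form `u_f`"
  as a `K`-map `π_j ⊇ θ(J⁺) → 𝔭₊ ⊗ (multiplicity)`, l. 371.]
* §2 the junk shell of pv08-g2 (`K = S¹ × D₄`, Haar probability measure, `C = C(K, Idx →ᵇ ℂ)`, right translation,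
  forms `form w i`) FACTORS through `U(2) × U(1)`: `κ (z, g) := (ρ_F g, z̄)` with `ρ_F(D₄) ⊆ U(2)` (`ρF_mem_unitaryGroup`:
  the reflection representation is unitary, `χ i · χ̄ i = 1`, `χ_mul_conj`) and `pPlusMat ∘ κ = ρ` (`pPlusMat_comp_κ`); the central
  element `k₀ = (e^{2πi√2}, 1) ↦ diagK 1 1 d₀`, `d₀ = e^{-2πi√2}` of infinite order (pv08-g2 `ξ_pow_ne_one`).
* §3 `fockBridge_of_core : N19g_core T V c D k l → QautFockBridge T V c D k l` (theta maps `ψOf (form (ind a) 0)`,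
  `ψOf (form 1 1)`; Fock vectors `(2 c_a) • z₁`, `z₂` in the harmonic plane; the (eq:seesaw) field then reads exactly as
  pv08-g2's `decomp` computation `toHG_pr`), **`nonempty_fockBridge_iff : Nonempty (QautFockBridge T V c D k l) ↔
  N19g_core T V c D k l`**, `nonempty_fockBridge_iff_qautBridge`, and the binder-level `fockBridges_iff_core`.

READING (boundary census, not mathematics of [PerL]): the S5 (34)-binder "a `QautFockBridge` in every good context" that
`S5QautFock.open_thetaReal34_of_fockBridges` consumes is ≡ the model-level leaf binder `hcore` of
`AssemblyLeaves.N19g_genInWedgeSpan_of_core` — sharpening the dictionary did NOT smuggle in strength; what it did is move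
the `K`-type bookkeeping from labelled text to theorems (F1) and expose the single equivariance sentence (D4/D5) as the
remaining dictionary.

Unit `pub-hodgecm-pv08-g4`, 2026-08-18.  Fully kernel-checked; standard axiom trio.
-/

set_option autoImplicit false

noncomputable section

open MeasureTheory Matrix MvPolynomial Complex
open HodgeCM.Prior.Perl34File
open HodgeCM.PerL34.Qaut
open HodgeCM.PerL34.P43KTypesU2 (mat pPlus pPlus_apply fockRep fockRep_apply substHom substVar diagK mat_diagK diagK_snd
  jplusSubmodule mem_jplusSubmodule Jplus Jplus_apply_coe zLin zLin_apply zLin_equivariant zLin_mem_jplus coeff_zLin)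

namespace HodgeCM
namespace PerL34
namespace QautFock

/-! ## §1. The lowest-`K`-type projection `J⁺ → 𝔭₊` and its `K`-equivariance -/

/-- the `z`-degree weight: `z_a ↦ 1`, `w ↦ 0`. -/
def zWt : Fock.HarmVar → ℕ
  | Sum.inl _ => 1
  | Sum.inr _ => 0

/-- (Ported verbatim from the HodgeCMPerL package; no docstring in the source.) -/
theorem weight_zWt_eq (m : Fock.HarmVar →₀ ℕ) : Finsupp.weight zWt m = zdeg m := by
  rw [Finsupp.weight_apply, Finsupp.sum_fintype _ _ (fun _ => by simp)]
  simp only [zWt, Fintype.sum_sum_type, Fin.sum_univ_two, Fintype.sum_unique, smul_eq_mul, mul_one, mul_zero,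
    add_zero]
  rfl

/-- The substituted variables are `z`-homogeneous of the `z`-degree of the variable (`z_a ↦ Σ_b A_{ba} z_b`, `w ↦ d̄ w`). -/
theorem isWeightedHomogeneous_substVar_z (k : P43KTypesU2.K) (v : Fock.HarmVar) :
    IsWeightedHomogeneous zWt (substVar k v) (zWt v) := by
  cases v with
  | inl a =>
    show IsWeightedHomogeneous zWt (∑ b : Fin 2, (mat k) b a • X (Sum.inl b)) (zWt (Sum.inl a))
    refine IsWeightedHomogeneous.sum _ _ _ (fun b _ => ?_)
    rw [smul_eq_C_mul]
    exact (isWeightedHomogeneous_X ℂ zWt (Sum.inl b)).C_mul _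
  | inr u =>
    show IsWeightedHomogeneous zWt (star (k.2 : ℂ) • X (Sum.inr u)) (zWt (Sum.inr u))
    rw [smul_eq_C_mul]
    exact (isWeightedHomogeneous_X ℂ zWt (Sum.inr u)).C_mul _

/-- **`substHom k` preserves `z`-degree** (the `zWt`-twin of pv14-g3's `isWeightedHomogeneous_substHom`). -/
theorem isWeightedHomogeneous_substHom_z (k : P43KTypesU2.K) {f : Fock.HarmModel} {n : ℕ}
    (hf : IsWeightedHomogeneous zWt f n) : IsWeightedHomogeneous zWt (substHom k f) n := by
  rw [f.as_sum, map_sum]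
  refine IsWeightedHomogeneous.sum _ _ _ (fun d hd => ?_)
  have hn : Finsupp.weight zWt d = n := hf (mem_support_iff.mp hd)
  rw [substHom, aeval_monomial, ← hn, MvPolynomial.algebraMap_eq, Finsupp.weight_apply, Finsupp.sum,
    Finsupp.prod]
  refine IsWeightedHomogeneous.C_mul ?_ _
  refine IsWeightedHomogeneous.prod _ _ _ (fun v _ => ?_)
  exact (isWeightedHomogeneous_substVar_z k v).pow (d v)

/-- **the lowest-`K`-type projection**: `p ↦ (coeff_{z₁} p, coeff_{z₂} p)`. -/
def cv : Fock.HarmModel →ₗ[ℂ] (Fin 2 → ℂ) where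
  toFun p a := coeff (Finsupp.single (Sum.inl a) 1) p
  map_add' p q := funext fun a => coeff_add _ p q
  map_smul' r p := funext fun a => by rw [coeff_smul, RingHom.id_apply, Pi.smul_apply]

/-- (Ported verbatim from the HodgeCMPerL package; no docstring in the source.) -/
theorem cv_apply (p : Fock.HarmModel) (a : Fin 2) : cv p a = coeff (Finsupp.single (Sum.inl a) 1) p := rfl

/-- (Ported verbatim from the HodgeCMPerL package; no docstring in the source.) -/
theorem cv_zLin (v : Fin 2 → ℂ) : cv (zLin v) = v := funext fun a => coeff_zLin v a

/-- (Ported verbatim from the HodgeCMPerL package; no docstring in the source.) -/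
theorem cv_eq_zero_of_isWeightedHomogeneous {φ : Fock.HarmModel} {n : ℕ} (h : IsWeightedHomogeneous zWt φ n)
    (hn : n ≠ 1) : cv φ = 0 := by
  funext a
  rw [cv_apply, Pi.zero_apply]
  refine h.coeff_eq_zero _ ?_
  rw [weight_zWt_eq, zdeg_single]
  exact fun h1 => hn h1.symm

/-- a monomial of `z`-degree `≠ 1` contributes nothing to `cv ∘ fockRep k`. -/
theorem cv_fockRep_monomial (k : P43KTypesU2.K) (m : Fock.HarmVar →₀ ℕ) (r : ℂ) (hm : zdeg m ≠ 1) :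
    cv (fockRep k (monomial m r)) = 0 := by
  rw [fockRep_apply, map_smul,
    cv_eq_zero_of_isWeightedHomogeneous
      (isWeightedHomogeneous_substHom_z k (isWeightedHomogeneous_monomial zWt m r (weight_zWt_eq m))) hm,
    smul_zero]

/-- `zPart 1 p = zLin (cv p)` (F1 `zPart_one_eq_zLin`, restated with `cv`). -/
theorem zPart_one_eq_zLin_cv {p : Fock.HarmModel} (hp : p ∈ jplusSubmodule) : zPart 1 p = zLin (cv p) :=
  zPart_one_eq_zLin hp

/-- **The lowest-`K`-type projection is `K`-equivariant on the `J⁺`-piece**: `cv (k · p) = 𝔭₊(k) (cv p)` for every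
`k ∈ U(2) × U(1)`. -/
theorem cv_fockRep (k : P43KTypesU2.K) {p : Fock.HarmModel} (hp : p ∈ jplusSubmodule) :
    cv (fockRep k p) = pPlus k (cv p) := by
  have hsplit : p = zPart 1 p + ∑ m ∈ p.support with ¬(zdeg m = 1), monomial m (coeff m p) := by
    unfold zPart
    rw [Finset.sum_filter_add_sum_filter_not]
    exact p.as_sum
  conv_lhs => rw [hsplit]
  rw [map_add, map_add, map_sum, map_sum, Finset.sum_eq_zero (fun m hm => ?_), add_zero,
    zPart_one_eq_zLin_cv hp, ← zLin_equivariant, cv_zLin]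
  exact cv_fockRep_monomial k m _ (Finset.mem_filter.mp hm).2

/-- **the theta map of a form**: `ψOf u := u ∘ cv` on the `J⁺`-piece. -/
def ψOf {C : Type*} [AddCommGroup C] [Module ℂ C] (u : (Fin 2 → ℂ) →ₗ[ℂ] C) : jplusSubmodule →ₗ[ℂ] C :=
  u ∘ₗ cv ∘ₗ jplusSubmodule.subtype

/-- (Ported verbatim from the HodgeCMPerL package; no docstring in the source.) -/
theorem ψOf_apply {C : Type*} [AddCommGroup C] [Module ℂ C] (u : (Fin 2 → ℂ) →ₗ[ℂ] C) (p : jplusSubmodule) :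
    ψOf u p = u (cv (p : Fock.HarmModel)) := rfl

/-- (Ported verbatim from the HodgeCMPerL package; no docstring in the source.) -/
theorem ψOf_zLinJ {C : Type*} [AddCommGroup C] [Module ℂ C] (u : (Fin 2 → ℂ) →ₗ[ℂ] C) (x : Fin 2 → ℂ) :
    ψOf u (zLinJ x) = u x := by
  rw [ψOf_apply, zLinJ_coe, cv_zLin]

/-- the canonical one-form of the theta map of a form is the form. -/
theorem formOf_ψOf {C : Type*} [AddCommGroup C] [Module ℂ C] (u : (Fin 2 → ℂ) →ₗ[ℂ] C) : formOf (ψOf u) = u :=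
  LinearMap.ext fun x => by rw [formOf_apply, ψOf_zLinJ]

/-- **A form of a shell factoring through `U(2) × U(1)` yields a `K`-EQUIVARIANT theta map.** -/
theorem ψOf_equivariant {K C : Type*} [Group K] [NormedCommRing C] [NormedAlgebra ℂ C] (κ : K →* P43KTypesU2.K)
    (σ : K →* (C →ₐ[ℂ] C)) (u : (Fin 2 → ℂ) →ₗ[ℂ] C) (hu : IsForm (pPlusMat.comp κ) σ u) (x : K)
    (p : jplusSubmodule) : σ x (ψOf u p) = ψOf u (Jplus (κ x) p) := by
  rw [ψOf_apply, ψOf_apply, hu, MonoidHom.comp_apply, pPlusMat_mulVec, Jplus_apply_coe, cv_fockRep _ p.2]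

/-! ## §2. pv08-g2's junk shell factors through `U(2) × U(1)` -/

namespace Conservative

open S5ConservativeQaut

attribute [local instance] S5ConservativeQaut.topD4 S5ConservativeQaut.measD4 S5ConservativeQaut.measCircle

/-- (Ported verbatim from the HodgeCMPerL package; no docstring in the source.) -/
theorem χ_mul_conj (i : ZMod 4) : S5ConservativeQaut.χ i * (starRingEnd ℂ) (S5ConservativeQaut.χ i) = 1 := by
  unfold S5ConservativeQaut.χ
  rw [map_pow, ← mul_pow, Complex.conj_I, mul_neg, Complex.I_mul_I, neg_neg, one_pow]

/-- (Ported verbatim from the HodgeCMPerL package; no docstring in the source.) -/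
theorem conj_χ_mul (i : ZMod 4) : (starRingEnd ℂ) (S5ConservativeQaut.χ i) * S5ConservativeQaut.χ i = 1 := by
  rw [mul_comm, χ_mul_conj]

/-- the reflection representation of `D₄` is unitary. -/
theorem ρF_mem_unitaryGroup (a : D4) : ρF a ∈ Matrix.unitaryGroup (Fin 2) ℂ := by
  rw [Matrix.mem_unitaryGroup_iff]
  rcases a with i | i
  · show ρFfun _ * star (ρFfun _) = 1
    simp only [ρFfun]
    ext p q
    fin_cases p <;> fin_cases q <;>
      simp [Matrix.mul_apply, Fin.sum_univ_two, Matrix.star_apply, χ_mul_conj]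
  · show ρFfun _ * star (ρFfun _) = 1
    simp only [ρFfun]
    ext p q
    fin_cases p <;> fin_cases q <;>
      simp [Matrix.mul_apply, Fin.sum_univ_two, Matrix.star_apply, χ_mul_conj]

/-- `ρ_F` as a homomorphism into `U(2)`. -/
def ρFU : D4 →* Matrix.unitaryGroup (Fin 2) ℂ := ρF.codRestrict _ ρF_mem_unitaryGroup

/-- (Ported verbatim from the HodgeCMPerL package; no docstring in the source.) -/
@[simp] theorem coe_ρFU (a : D4) : ((ρFU a : Matrix.unitaryGroup (Fin 2) ℂ) : Matrix (Fin 2) (Fin 2) ℂ) = ρF a := rfl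

/-- (Ported verbatim from the HodgeCMPerL package; no docstring in the source.) -/
theorem star_coe_mem_unitary (z : Circle) : star (z : ℂ) ∈ unitary ℂ := by
  have h1 : (z : ℂ) * star (z : ℂ) = 1 := by
    rw [Complex.star_def, Complex.mul_conj, Circle.normSq_coe, Complex.ofReal_one]
  rw [Unitary.mem_iff, star_star]
  exact ⟨h1, by rw [mul_comm, h1]⟩

/-- `z ↦ z̄` as a homomorphism `S¹ → U(1)`. -/
def cU : Circle →* unitary ℂ where
  toFun z := ⟨star (z : ℂ), star_coe_mem_unitary z⟩
  map_one' := Subtype.ext (by simp)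
  map_mul' z w := Subtype.ext (by
    show star ((z * w : Circle) : ℂ) = star (z : ℂ) * star (w : ℂ)
    rw [Circle.coe_mul, star_mul'])

/-- (Ported verbatim from the HodgeCMPerL package; no docstring in the source.) -/
@[simp] theorem coe_cU (z : Circle) : ((cU z : unitary ℂ) : ℂ) = star (z : ℂ) := rfl

/-- **the factorisation** `κ (z, g) = (ρ_F g, z̄)`. -/
def κ : S5ConservativeQaut.K →* P43KTypesU2.K :=
  MonoidHom.prod (ρFU.comp (MonoidHom.snd Circle D4)) (cU.comp (MonoidHom.fst Circle D4))

/-- (Ported verbatim from the HodgeCMPerL package; no docstring in the source.) -/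
theorem κ_apply (x : S5ConservativeQaut.K) : κ x = (ρFU x.2, cU x.1) := rfl

/-- `pPlusMat ∘ κ = ρ` pointwise … -/
theorem pPlusMat_κ (x : S5ConservativeQaut.K) : pPlusMat (κ x) = S5ConservativeQaut.ρ x := by
  rw [pPlusMat_apply, κ_apply, ρ_apply]
  show star (star (x.1 : ℂ)) • ρF x.2 = (x.1 : ℂ) • ρF x.2
  rw [star_star]

/-- … and as homomorphisms. -/
theorem pPlusMat_comp_κ : pPlusMat.comp κ = S5ConservativeQaut.ρ := MonoidHom.ext pPlusMat_κ

/-- (Ported verbatim from the HodgeCMPerL package; no docstring in the source.) -/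
theorem κ_cont : Continuous κ := by
  have h1 : Continuous fun x : S5ConservativeQaut.K => ρFU x.2 :=
    (continuous_of_discreteTopology (f := fun g : D4 => ρFU g)).comp continuous_snd
  have h2 : Continuous fun x : S5ConservativeQaut.K => cU x.1 :=
    continuous_induced_rng.2 ((continuous_subtype_val.comp continuous_fst).star)
  exact h1.prodMk h2

/-- `d₀ = e^{-2πi√2}`. -/
def d₀ : unitary ℂ := cU (Circle.exp (2 * Real.pi * Real.sqrt 2))

/-- (Ported verbatim from the HodgeCMPerL package; no docstring in the source.) -/
theorem coe_d₀ : (d₀ : ℂ) = star S5ConservativeQaut.ξ := rfl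

/-- (Ported verbatim from the HodgeCMPerL package; no docstring in the source.) -/
theorem κ_k₀ : κ S5ConservativeQaut.k₀ = diagK 1 1 d₀ := by
  refine Prod.ext (Subtype.ext ?_) rfl
  show ((ρFU (1 : D4) : Matrix.unitaryGroup (Fin 2) ℂ) : Matrix (Fin 2) (Fin 2) ℂ) =
    Matrix.diagonal ![((1 : unitary ℂ) : ℂ), ((1 : unitary ℂ) : ℂ)]
  rw [coe_ρFU, map_one]
  ext i j
  fin_cases i <;> fin_cases j <;> simp [Matrix.diagonal]

/-- (Ported verbatim from the HodgeCMPerL package; no docstring in the source.) -/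
theorem d₀_pow_ne_one (m : ℕ) (hm : 1 ≤ m) : (d₀ : ℂ) ^ m ≠ 1 := by
  intro h
  apply S5ConservativeQaut.ξ_pow_ne_one m hm
  have := congrArg star h
  rwa [coe_d₀, star_pow, star_star, star_one] at this

/-- (Ported verbatim from the HodgeCMPerL package; no docstring in the source.) -/
theorem ρ_diag_κ : ∃ x s t, s ≠ t ∧ pPlusMat (κ x) = !![s, 0; 0, t] := by
  simp_rw [pPlusMat_κ]; exact S5ConservativeQaut.ρ_diag

/-- (Ported verbatim from the HodgeCMPerL package; no docstring in the source.) -/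
theorem ρ_antidiag_κ : ∃ x a b, pPlusMat (κ x) = !![0, a; b, 0] := by
  simp_rw [pPlusMat_κ]; exact S5ConservativeQaut.ρ_antidiag

/-- the forms of the junk shell are forms for `pPlusMat ∘ κ`. -/
theorem isForm_form_κ {X : Type*} (s : Set X) (w : B s) (i : Fin 2) : IsForm (pPlusMat.comp κ) (σ s) (form s w i) := by
  rw [pPlusMat_comp_κ]; exact isForm_form s w i

/-! ## §3. The junk Fock bridge over the leaf, and conservativity -/

section Bridge

variable {U : Universe} (T : U.ThetaModel)
variable {L : CMField} {ι₁ : L →+* ℂ} (V : HermSpace3 L ι₁) (c : SeesawCtx L)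
variable (D : Perl34.TorusData (T.core V c)) (k l : Fin 4)

/-- **The junk Fock bridge**: every field of `QautFockBridge` discharged over the leaf `N19g_core`. -/
def fockBridge_of_core (hcore : N19g_core T V c D k l) : QautFockBridge T V c D k l where
  K := S5ConservativeQaut.K
  μ := S5ConservativeQaut.μ
  C := S5ConservativeQaut.C (T.wedgeSet V c k l)
  σ := σ _
  σ_cont := σ_cont _
  κ := κ
  κ_cont := κ_cont
  ρ_diag := ρ_diag_κ
  ρ_antidiag := ρ_antidiag_κ
  k₀ := S5ConservativeQaut.k₀
  d₀ := d₀
  κ_k₀ := κ_k₀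
  d₀_pow_ne_one := d₀_pow_ne_one
  toHG := toHG T V c k l
  Ψ₁ := fun _ => Set.range fun a : WIdx T V c k l => ψOf (form _ (S5ConservativeQaut.ind _ a) 0)
  Ψ₂ := fun _ => {ψOf (form _ 1 1)}
  equiv₁ := by
    rintro _ _ ⟨a, rfl⟩ x p
    exact ψOf_equivariant κ (σ _) _ (isForm_form_κ _ _ _) x p
  equiv₂ := by
    rintro _ _ rfl x p
    exact ψOf_equivariant κ (σ _) _ (isForm_form_κ _ _ _) x p
  wedge_mem := by
    rintro _ _ _ ⟨a, rfl⟩ _ rfl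
    rw [formOf_ψOf, formOf_ψOf, toHG_wedge]
    exact a.mem
  P := hcore.choose
  dense := hcore.choose_spec.1
  seesawPure := by
    intro χ hχ Φ hΦ
    have hy : D.ϑ χ Φ ∈ Submodule.span ℂ (T.wedgeSet V c k l) := hcore.choose_spec.2 χ hχ Φ hΦ
    obtain ⟨cf, hsupp, hsum⟩ := Submodule.mem_span_set.mp hy
    set n : ℕ := cf.support.card
    let en : Fin n ≃ {g // g ∈ cf.support} := (cf.support.equivFin).symm
    let a : Fin n → WIdx T V c k l := fun i => ⟨(en i).val, hsupp (en i).property⟩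
    refine ⟨n, fun i => ψOf (form _ (S5ConservativeQaut.ind _ (a i)) 0), fun _ => ψOf (form _ 1 1),
      fun i => (2 * cf (a i).val) • zLinJ (e 0), fun _ => zLinJ (e 1), fun i => ⟨⟨a i, rfl⟩, rfl⟩, ?_⟩
    rw [pPlusMat_comp_κ, map_sum]
    simp_rw [map_smul, ψOf_zLinJ, toHG_pr]
    rw [← hsum, Finsupp.sum]
    have h2 : ∀ i : Fin n, (2 * cf (a i).val / 2) • (a i).val = cf (en i).val • (en i).val := by
      intro i
      rw [mul_div_cancel_left₀ _ (two_ne_zero' ℂ)]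
    simp_rw [h2]
    exact ((Equiv.sum_comp en (fun g : {g // g ∈ cf.support} => cf g.val • g.val)).trans
      (Finset.sum_coe_sort cf.support (fun g => cf g • g))).symm

/-- **`N19g_core → Nonempty QautFockBridge`**. -/
theorem nonempty_fockBridge_of_core (hcore : N19g_core T V c D k l) : Nonempty (QautFockBridge T V c D k l) :=
  ⟨fockBridge_of_core T V c D k l hcore⟩

/-- **CONSERVATIVITY of the sharpened S5 record**: in logical strength `QautFockBridge` is exactly the leaf `N19g_core`
(→ : F1 `N19g_core_of_fockBridge`; ← : the junk instance above). -/
theorem nonempty_fockBridge_iff : Nonempty (QautFockBridge T V c D k l) ↔ N19g_core T V c D k l :=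
  ⟨fun ⟨B⟩ => N19g_core_of_fockBridge B, nonempty_fockBridge_of_core T V c D k l⟩

/-- … hence exactly the landed record (pv08-g2 `nonempty_qautBridge_iff`). -/
theorem nonempty_fockBridge_iff_qautBridge :
    Nonempty (QautFockBridge T V c D k l) ↔ Nonempty (QautDictionary.QautBridge T V c D k l) := by
  rw [nonempty_fockBridge_iff, S5ConservativeQaut.nonempty_qautBridge_iff]

end Bridge

section Binder

variable {U : Universe} (T : U.ThetaModel)

/-- **Binder-level form**: the hypothesis of `S5QautFock.open_thetaReal34_of_fockBridges` ("a Fock bridge in every good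
context on the `(34)` side") is EQUIVALENT to the model-level leaf binder `hcore` of
`AssemblyLeaves.N19g_genInWedgeSpan_of_core` / `OpenInputsN19.open_thetaReal34_of_core`. -/
theorem fockBridges_iff_core :
    (∀ {L : CMField} {ι₁ : L →+* ℂ} (V : HermSpace3 L ι₁) (c : SeesawCtx L), T.GoodCtx ι₁ c →
      Nonempty (QautFockBridge T V c (T.t34 V c) 2 3)) ↔
    (∀ {L : CMField} {ι₁ : L →+* ℂ} (V : HermSpace3 L ι₁) (c : SeesawCtx L), T.GoodCtx ι₁ c →
      N19g_core T V c (T.t34 V c) 2 3) :=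
  ⟨fun h _ _ V c hc => (nonempty_fockBridge_iff T V c _ 2 3).mp (h V c hc),
   fun h _ _ V c hc => (nonempty_fockBridge_iff T V c _ 2 3).mpr (h V c hc)⟩

end Binder

end Conservative

end QautFock
end PerL34
end HodgeCM

end
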